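import Summits.QuantumFields.YangMills.Theorems.FluctuationComparisonRegPrIntLS2BetaResidualGauge
import Summits.QuantumFields.YangMills.Theorems.FluctuationComparisonRegPrIntLS2BetaGeodesicJensenLift
import Literature.MathematicalPhysics.QuantumFieldTheory.Balaban1983to89.T3SectALandauChart
import HarnessLib

/-!
# S2β · GAP♯∘ — (RES-u.7σ) «THE SMOOTH RESIDUAL COPY OF THE BACKGROUND»: from a fine small-bond gauge `g` of `U₀` and ANY fine lift `ǧ` of `g↓` with small
# fine gradient, the RESIDUAL transformation `r := ǧ⁻¹·g` gives a copy `r•U₀` IN THE SAME FIBRE ∕ ARGMIN SET with `dist1 ((r•U₀) b) ≤ s + γ` on EVERY fine bond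

Cell `ym3-torus` (rung R3 = continuum `SU(2)` YM₃ on T³ at fixed lattice data — NOT d = 4, NOT infinite volume, NOT a mass gap, NOT Clay).  Width seat
`ym-ust-20520-w5` (gen 29), explicit-unit helper on crux `stmt-QuantumFields-20520` `FluctuationComparisonRegPrIntL`, LINE g18-1 S2β (registry untouched), organ GAP♯∘,
node (RES-u).  Desk ★★OWNER g50 RULING №131 (2026-09-01T02:03:49Z), on px21 g26's count «E_J-FACE» (01:57:55Z): at the residual test point the finest relative field
carries `D(b) = [U₀(b), c_y⁻¹]·(c_y⁻¹c_x)`, `dist1 (D b) ≤ 4σ₀(b) + γ(b)` — the lift's fine gradient `γ` (exit (a): px21's ⧗(RES-u.7) Lipschitz lift) AND the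
background's own fine bond size `σ₀(b)`, which in a residual-AXIAL copy of `U₀` is window-size on the top faces.  THE ROW (iii): present `U₀` by a RESIDUAL copy
with fine-small bonds everywhere.  SUPPLY BY NAME: (i) a fine small-bond gauge `g` of `U₀` (`hBG` read at level `K`: `dist1 ((g•U₀) b) ≤ s`, `s = L^{−(K−J)}·O(window)`),
(ii) a fine lift `ǧ` of the coarse shadow `g↓` with fine gradient `≤ γ` ((RES-u.7), px21 g26: `γ = C_lift·τ′·L^{−(K−J)}`), (iii) THIS FILE: `r := ǧ⁻¹·g`.
* §1 ★`residual_liftInv_mul (hǧ : ǧ↓ = g↓)`: `r` is RESIDUAL (`r↓ = (ǧ↓)⁻¹·g↓ ≡ 1`, lit ✓`descTransf_mul`∕✓`descTransf_inv`, ✓`residual_of_descTransf_eq_one`).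
* §2 `gaugeAct_liftInv_mul_apply`: `(r•U₀) b = (ǧ b₋)⁻¹·(g•U₀) b·ǧ b₊`; ★`dist1_residualCopy_le (hg) (hγ)`: `dist1 ((r•U₀) b) ≤ s + γ` (conjugation by `(ǧ b₋)⁻¹`, `dist1_mul_le`,
  gradient read `tgt·src⁻¹` as in (RES-u.7)).
* §3 ★★★`exists_smoothResidualCopy (hg) (hlift : ∃ û, û↓ = g↓ ∧ ∀ b, dist1 (û b₊·(û b₋)⁻¹) ≤ γ) : ∃ r residual, ∀ b, dist1 ((r•U₀) b) ≤ s + γ` — `hlift` in px21's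
  export shape.
* §4 WLOG COMPANIONS (cited by name, one line each): the copy stays in the fibre ∕ `histGood` ∕ the argmin set (✓`gaugeAct_mem_fibre_iff_of_residual`,
  ✓`gaugeAct_mem_histGood_iff`, ✓`gaugeAct_mem_argmin_iff_of_residual`) — packaged as `exists_smoothResidualCopy_mem_argmin` and, in `hBG`'s ARC currency
  (`‖logVec (su2Quat ((g•U₀) e))‖ ≤ s`, chord ≤ arc ✓`dist1_le_norm_logVec`), `exists_smoothResidualCopy_mem_argmin_of_arc`; the residual-orbit infimum is unchanged
  (`w ↦ w·r`, px16 g24's ✓∕⧗`…BodyRebaseLift.iInf_orbitDistSq_gaugeAct_residual_bkg`, not restated).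
* §6 (ii)'s SMALLNESS INPUT (architect px17 g23 02:05Z (3)): ★`bondGrad_descTransf_le_of_descent` — `dist1 (g↓ B₊·(g↓ B₋)⁻¹) ≤ s′ + σ_V` from `dist1 ((g•U₀)↓ B) ≤ s′`
  and `dist1 (V B) ≤ σ_V` (`(g•U₀)↓ = g↓•V`, lit ✓`descendTo_gaugeAct`) — the `hgrad` of (RES-u.7) at `t := g↓`, `tgt·src⁻¹`.
* §5 THE THM-2 REPRESENTATIVE MOVES COVARIANTLY: `u⁻¹•U = E·U₀` ⟹ `(u·r⁻¹)⁻¹•U = (r₋ E r₋⁻¹)·(r•U₀)`, with `(u·r⁻¹)↓ = u↓` and `dist1 (r₋·E b·r₋⁻¹) = dist1 (E b)` — so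
  every (RES-u) letter (✓p839678, ✓p839899, ✓p839886, (RES-u.4′)) is read at the copy with the same constants.
`--kind proof --supports stmt-QuantumFields-20520 --as helper`, DEFINITION-FREE (0 `def`, 0 `instance`, 0 `sorry`; default heartbeats).

HONEST.  Pointwise group algebra over landed lemmas; `hg` (= the conjectured small-bond gauge letter `hBG` instantiated at level `K`) and `hlift` (= (RES-u.7), px21 g26, in
window) are HYPOTHESES displayed in the binders; nothing of Bałaban's analysis is asserted or proved ([Balaban1985Averaging] (8) p.18, (11)–(13) p.19: gauge action,
descent of gauge transformations; [Balaban1985Variational] (4) p.278, Thm 1 (8) p.279: the residual group and the minimal orbit; [Balaban1985RegularSpaces] Thm 2 p.83,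
(1.29) p.81: the representative); GAP♯∘ (`stub_uniformFibreGapOrbit`, 0∕5), the five REGISTERED stubs, S2β, crux 20520, 19936, 19200, `YM3TorusSU2` NOT proved; no summit
statement is proved by a helper; rung R3 = SU(2) YM₃ on T³ — NOT d = 4, NOT infinite volume, NOT a mass gap, NOT Clay; the Yang–Mills mass gap is NOT proved.
-/

set_option autoImplicit false

noncomputable section

namespace Summit.QuantumFields.YangMills.Theorems.FluctuationComparisonRegPrIntLS2BetaSmoothResidualCopy

open Literature.MathematicalPhysics.QuantumFieldTheory.Balaban1983to89
open T4Continuum T3ContinuumYM3Torus T3UnitScaleTilt T3TiltDescent T3LevelShift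
open T3UnitLawDensityEML (ℰp)
open T3ConstrainedMinimiser (fibre)
open T3PrintedRegularMinimiser (minActionRegPr)
open T3PrintedRegularOrbits (descTransf descendTo_gaugeAct)
open T3SectALandauChart (descTransf_inv descTransf_mul)
open Literature.MathematicalPhysics.QuantumLattice (su2Quat)
open T4ExpWindowSmallField (logVec)
open Summit.QuantumFields.YangMills.Theorems.FluctuationComparisonRegPrIntLS2BetaGeodesicJensenLift (dist1_le_norm_logVec)
open Summit.QuantumFields.YangMills.Theorems.FluctuationComparisonRegPrIntLS2BetaResidualGauge
  (residual_of_descTransf_eq_one gaugeAct_mem_fibre_iff_of_residual gaugeAct_mem_histGood_iff gaugeAct_mem_argmin_iff_of_residual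
    residual_inv gaugeAct_mul_eq)

/-! ## §1 `r := ǧ⁻¹·g` is residual when `ǧ` lifts `g↓` -/

section Residual

variable (F : T3Family) {J K : ℕ} (hJK : J ≤ K)

/-- ★ **`r := ǧ⁻¹·g` IS RESIDUAL** whenever `ǧ` has the same coarse shadow as `g` (`ǧ↓ = g↓`): `r↓ = (ǧ↓)⁻¹·g↓ ≡ 1`.
[cite: Balaban1985Averaging, (11)-(13) p.19; Balaban1985Variational, (4) p.278] -/
theorem residual_liftInv_mul {g gl : Site (F.P K) 0 → Matrix.specialUnitaryGroup (Fin 2) ℂ}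
    (hgl : descTransf F J K hJK gl = descTransf F J K hJK g) :
    ∀ U : GaugeField (F.P K) 0 (Matrix.specialUnitaryGroup (Fin 2) ℂ),
      descendTo F ℰp J K hJK (GaugeField.gaugeAct (fun x => (gl x)⁻¹ * g x) U) = descendTo F ℰp J K hJK U := by
  refine residual_of_descTransf_eq_one F hJK ?_
  rw [descTransf_mul, descTransf_inv, hgl]
  funext x
  exact inv_mul_cancel _

end Residual

/-! ## §2 The copy's bonds: `(r•U₀) b = (ǧ b₋)⁻¹·(g•U₀) b·ǧ b₊`, of size `≤ s + γ` -/

section Bonds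

variable {P : Params} {j : ℕ} {G : Type*} [GaugeGroup G]

/-- `((ǧ⁻¹·g)•U₀) b = (ǧ b₋)⁻¹·((g•U₀) b)·ǧ b₊` (pointwise). [cite: Balaban1985Averaging, (8) p.18] -/
theorem gaugeAct_liftInv_mul_apply (g gl : Site P j → G) (U₀ : GaugeField P j G) (b : PBond P j) :
    GaugeField.gaugeAct (fun x => (gl x)⁻¹ * g x) U₀ b = (gl b.src)⁻¹ * GaugeField.gaugeAct g U₀ b * gl b.tgt := by
  simp only [GaugeField.gaugeAct, mul_inv_rev, inv_inv, mul_assoc]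

/-- `dist1 ((ǧ b₋)⁻¹·X·ǧ b₊) ≤ dist1 X + dist1 (ǧ b₊·(ǧ b₋)⁻¹)`: conjugate by `(ǧ b₋)⁻¹` and split. [folklore] -/
theorem dist1_invConj_le (a c X : G) : dist1 (a⁻¹ * X * c) ≤ dist1 X + dist1 (c * a⁻¹) := by
  have h : a⁻¹ * X * c = a⁻¹ * (X * (c * a⁻¹)) * a⁻¹⁻¹ := by group
  rw [h, GaugeGroup.dist1_conj]
  exact GaugeGroup.dist1_mul_le _ _

/-- ★ **THE COPY HAS SMALL BONDS EVERYWHERE**: `dist1 ((g•U₀) b) ≤ s` on every bond and `dist1 (ǧ b₊·(ǧ b₋)⁻¹) ≤ γ` on every bond ⟹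
`dist1 (((ǧ⁻¹·g)•U₀) b) ≤ s + γ` on every bond (faces included). [cite: Balaban1985Averaging, (8) p.18] -/
theorem dist1_residualCopy_le {g gl : Site P j → G} {U₀ : GaugeField P j G} {s γ : ℝ}
    (hg : ∀ b : PBond P j, dist1 (GaugeField.gaugeAct g U₀ b) ≤ s)
    (hγ : ∀ b : PBond P j, dist1 (gl b.tgt * (gl b.src)⁻¹) ≤ γ) :
    ∀ b : PBond P j, dist1 (GaugeField.gaugeAct (fun x => (gl x)⁻¹ * g x) U₀ b) ≤ s + γ := by
  intro b
  rw [gaugeAct_liftInv_mul_apply]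
  exact (dist1_invConj_le _ _ _).trans (add_le_add (hg b) (hγ b))

end Bonds

/-! ## §3 The ∃-edition over (RES-u.7)'s export -/

section Exists

variable (F : T3Family) {J K : ℕ} (hJK : J ≤ K)

/-- ★★★ **THE SMOOTH RESIDUAL COPY EXISTS**: a fine gauge `g` with `dist1 ((g•U₀) b) ≤ s` on every fine bond (the small-bond gauge letter at level `K`) and a fine
lift `û` of `g↓` with fine gradient `≤ γ` ((RES-u.7)'s export at `t := g↓`) give a RESIDUAL `r` with `dist1 ((r•U₀) b) ≤ s + γ` on every fine bond.
[cite: Balaban1985Averaging, (8) p.18, (11)-(13) p.19; Balaban1985Variational, (4) p.278] -/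
theorem exists_smoothResidualCopy {g : Site (F.P K) 0 → Matrix.specialUnitaryGroup (Fin 2) ℂ}
    {U₀ : GaugeField (F.P K) 0 (Matrix.specialUnitaryGroup (Fin 2) ℂ)} {s γ : ℝ}
    (hg : ∀ b : PBond (F.P K) 0, dist1 (GaugeField.gaugeAct g U₀ b) ≤ s)
    (hlift : ∃ û : Site (F.P K) 0 → Matrix.specialUnitaryGroup (Fin 2) ℂ,
      descTransf F J K hJK û = descTransf F J K hJK g ∧ ∀ b : PBond (F.P K) 0, dist1 (û b.tgt * (û b.src)⁻¹) ≤ γ) :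
    ∃ r : Site (F.P K) 0 → Matrix.specialUnitaryGroup (Fin 2) ℂ,
      (∀ U : GaugeField (F.P K) 0 (Matrix.specialUnitaryGroup (Fin 2) ℂ),
          descendTo F ℰp J K hJK (GaugeField.gaugeAct r U) = descendTo F ℰp J K hJK U) ∧
        ∀ b : PBond (F.P K) 0, dist1 (GaugeField.gaugeAct r U₀ b) ≤ s + γ := by
  obtain ⟨û, hû, hγ⟩ := hlift
  exact ⟨fun x => (û x)⁻¹ * g x, residual_liftInv_mul F hJK hû, dist1_residualCopy_le hg hγ⟩

/-! ## §4 WLOG companions: the copy is an admissible background over the same datum -/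

/-- ★★ **THE SMOOTH RESIDUAL COPY OF A MINIMISER IS A MINIMISER OVER THE SAME DATUM**: under the hypotheses of `exists_smoothResidualCopy`, if `U₀` lies in the
argmin set over `V` (GAP♯∘'s set text), so does the copy `r•U₀`, which has `dist1 ≤ s + γ` bonds everywhere; `r` is residual, so every fibre and `histGood` are preserved too
(✓`gaugeAct_mem_argmin_iff_of_residual`, ✓`gaugeAct_mem_fibre_iff_of_residual`, ✓`gaugeAct_mem_histGood_iff`). [cite: Balaban1985Variational, Thm 1 (8) p.279, (4) p.278] -/
theorem exists_smoothResidualCopy_mem_argmin {γ' b₀ p₀ ε₀ : ℝ} {g : Site (F.P K) 0 → Matrix.specialUnitaryGroup (Fin 2) ℂ}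
    {V : GaugeField (F.P J) 0 (Matrix.specialUnitaryGroup (Fin 2) ℂ)}
    {U₀ : GaugeField (F.P K) 0 (Matrix.specialUnitaryGroup (Fin 2) ℂ)} {s γ : ℝ}
    (hU₀ : U₀ ∈ {U' : GaugeField (F.P K) 0 (Matrix.specialUnitaryGroup (Fin 2) ℂ) | U' ∈ fibre F ℰp J K hJK V ∧
      U' ∈ histGood F ℰp (θBal F.L γ' b₀ p₀) K J ∧ wilsonAction4 U' = minActionRegPr F J K hJK ε₀ V})
    (hg : ∀ b : PBond (F.P K) 0, dist1 (GaugeField.gaugeAct g U₀ b) ≤ s)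
    (hlift : ∃ û : Site (F.P K) 0 → Matrix.specialUnitaryGroup (Fin 2) ℂ,
      descTransf F J K hJK û = descTransf F J K hJK g ∧ ∀ b : PBond (F.P K) 0, dist1 (û b.tgt * (û b.src)⁻¹) ≤ γ) :
    ∃ r : Site (F.P K) 0 → Matrix.specialUnitaryGroup (Fin 2) ℂ,
      (∀ U : GaugeField (F.P K) 0 (Matrix.specialUnitaryGroup (Fin 2) ℂ),
          descendTo F ℰp J K hJK (GaugeField.gaugeAct r U) = descendTo F ℰp J K hJK U) ∧
        GaugeField.gaugeAct r U₀ ∈ {U' : GaugeField (F.P K) 0 (Matrix.specialUnitaryGroup (Fin 2) ℂ) | U' ∈ fibre F ℰp J K hJK V ∧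
          U' ∈ histGood F ℰp (θBal F.L γ' b₀ p₀) K J ∧ wilsonAction4 U' = minActionRegPr F J K hJK ε₀ V} ∧
        ∀ b : PBond (F.P K) 0, dist1 (GaugeField.gaugeAct r U₀ b) ≤ s + γ := by
  obtain ⟨r, hr, hb⟩ := exists_smoothResidualCopy F hJK hg hlift
  exact ⟨r, hr, (gaugeAct_mem_argmin_iff_of_residual F hJK hr U₀ V).mpr hU₀, hb⟩

/-- ★★★ **ARC-CURRENCY EDITION** (docks to the small-bond gauge letter `hBG` read at level `K`, whose conclusion is `‖logVec (su2Quat ((g•U₀) e))‖ ≤ C·√θ + c∕N`): arcs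
`≤ s` for `g•U₀` and a fine lift of `g↓` with gradient `≤ γ` ⟹ a RESIDUAL copy of `U₀` IN THE ARGMIN SET with `dist1 ≤ s + γ` bonds everywhere (chord `≤` arc,
✓`dist1_le_norm_logVec`). [cite: Balaban1985Variational, Thm 1 (8) p.279, (4) p.278; Balaban1985Averaging, (8) p.18, (11)-(13) p.19] -/
theorem exists_smoothResidualCopy_mem_argmin_of_arc {γ' b₀ p₀ ε₀ : ℝ} {g : Site (F.P K) 0 → Matrix.specialUnitaryGroup (Fin 2) ℂ}
    {V : GaugeField (F.P J) 0 (Matrix.specialUnitaryGroup (Fin 2) ℂ)}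
    {U₀ : GaugeField (F.P K) 0 (Matrix.specialUnitaryGroup (Fin 2) ℂ)} {s γ : ℝ}
    (hU₀ : U₀ ∈ {U' : GaugeField (F.P K) 0 (Matrix.specialUnitaryGroup (Fin 2) ℂ) | U' ∈ fibre F ℰp J K hJK V ∧
      U' ∈ histGood F ℰp (θBal F.L γ' b₀ p₀) K J ∧ wilsonAction4 U' = minActionRegPr F J K hJK ε₀ V})
    (hgArc : ∀ e : PBond (F.P K) 0, ‖logVec (su2Quat (GaugeField.gaugeAct g U₀ e))‖ ≤ s)
    (hlift : ∃ û : Site (F.P K) 0 → Matrix.specialUnitaryGroup (Fin 2) ℂ,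
      descTransf F J K hJK û = descTransf F J K hJK g ∧ ∀ b : PBond (F.P K) 0, dist1 (û b.tgt * (û b.src)⁻¹) ≤ γ) :
    ∃ r : Site (F.P K) 0 → Matrix.specialUnitaryGroup (Fin 2) ℂ,
      (∀ U : GaugeField (F.P K) 0 (Matrix.specialUnitaryGroup (Fin 2) ℂ),
          descendTo F ℰp J K hJK (GaugeField.gaugeAct r U) = descendTo F ℰp J K hJK U) ∧
        GaugeField.gaugeAct r U₀ ∈ {U' : GaugeField (F.P K) 0 (Matrix.specialUnitaryGroup (Fin 2) ℂ) | U' ∈ fibre F ℰp J K hJK V ∧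
          U' ∈ histGood F ℰp (θBal F.L γ' b₀ p₀) K J ∧ wilsonAction4 U' = minActionRegPr F J K hJK ε₀ V} ∧
        ∀ b : PBond (F.P K) 0, dist1 (GaugeField.gaugeAct r U₀ b) ≤ s + γ :=
  exists_smoothResidualCopy_mem_argmin F hJK hU₀ (fun b => (dist1_le_norm_logVec _).trans (hgArc b)) hlift

/-- Residual copies of ANY fine field stay in its fibre and keep `histGood` (the `U`-side companion, for re-basing the whole triple).
[cite: Balaban1985Variational, (4) p.278; Balaban1985UV3, (7) p.257] -/
theorem residualCopy_mem_fibre_histGood {r : Site (F.P K) 0 → Matrix.specialUnitaryGroup (Fin 2) ℂ}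
    (hr : ∀ U : GaugeField (F.P K) 0 (Matrix.specialUnitaryGroup (Fin 2) ℂ),
      descendTo F ℰp J K hJK (GaugeField.gaugeAct r U) = descendTo F ℰp J K hJK U)
    (θ : ℕ → ℝ) {U : GaugeField (F.P K) 0 (Matrix.specialUnitaryGroup (Fin 2) ℂ)} {V : GaugeField (F.P J) 0 (Matrix.specialUnitaryGroup (Fin 2) ℂ)}
    (hU : U ∈ fibre F ℰp J K hJK V) (hUg : U ∈ histGood F ℰp θ K J) :
    GaugeField.gaugeAct r U ∈ fibre F ℰp J K hJK V ∧ GaugeField.gaugeAct r U ∈ histGood F ℰp θ K J :=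
  ⟨(gaugeAct_mem_fibre_iff_of_residual F hJK hr U V).mpr hU, (gaugeAct_mem_histGood_iff F r θ J U).mpr hUg⟩

end Exists

/-! ## §5 The Thm-2 representative moves covariantly to the copy -/

section Representative

variable {P : Params} {j : ℕ} {G : Type*} [GaugeGroup G]

/-- **THE REPRESENTATIVE AT THE COPY**: `u⁻¹•U = E·U₀` ⟹ `(u·r⁻¹)⁻¹•U = E^{r}·(r•U₀)` with `E^{r} b := r b₋·E b·(r b₋)⁻¹` — the twist is CONJUGATED at the
source site, the background is replaced by its copy. [cite: Balaban1985RegularSpaces, (1.29) p.81, Thm 2 p.83; Balaban1985Averaging, (8) p.18] -/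
theorem rep_at_residualCopy (u r : Site P j → G) (E : PBond P j → G) (U₀ U : GaugeField P j G)
    (hrep : GaugeField.gaugeAct (fun x => (u x)⁻¹) U = fun b => E b * U₀ b) :
    GaugeField.gaugeAct (fun x => (u x * (r x)⁻¹)⁻¹) U = fun b => (r b.src * E b * (r b.src)⁻¹) * GaugeField.gaugeAct r U₀ b := by
  have h1 : (fun x => (u x * (r x)⁻¹)⁻¹) = r * fun x => (u x)⁻¹ := by
    funext x; rw [mul_inv_rev, inv_inv]; rfl
  rw [h1, gaugeAct_mul_eq, hrep]
  funext b
  simp only [GaugeField.gaugeAct, mul_assoc, inv_mul_cancel_left]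

/-- The conjugated twist has the same size: `dist1 (r b₋·E b·(r b₋)⁻¹) = dist1 (E b)`. [folklore] -/
theorem dist1_conj_twist (r : Site P j → G) (E : PBond P j → G) (b : PBond P j) :
    dist1 (r b.src * E b * (r b.src)⁻¹) = dist1 (E b) :=
  GaugeGroup.dist1_conj _ _

end Representative

section RepresentativeT3

variable (F : T3Family) {J K : ℕ} (hJK : J ≤ K)

/-- The new gauge `u·r⁻¹` has the SAME coarse shadow as `u` when `r` is the residual copy-maker `ǧ⁻¹·g` with `ǧ↓ = g↓`: `(u·r⁻¹)↓ = u↓` — so the coarse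
transformation `t = u↓`, its lifts and (RES-u.4′)'s gradient letters are untouched by the move to the copy. [cite: Balaban1985Averaging, (11)-(13) p.19] -/
theorem descTransf_mul_liftInv_mul_inv {u g gl : Site (F.P K) 0 → Matrix.specialUnitaryGroup (Fin 2) ℂ}
    (hgl : descTransf F J K hJK gl = descTransf F J K hJK g) :
    descTransf F J K hJK (fun x => u x * ((fun y => (gl y)⁻¹ * g y) x)⁻¹) = descTransf F J K hJK u := by
  rw [descTransf_mul, descTransf_inv, descTransf_mul, descTransf_inv, hgl]
  funext x
  simp only [inv_mul_cancel, inv_one, mul_one]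

end RepresentativeT3

/-! ## §6 (ii)'s smallness input: the coarse gradient of `g↓` from the descent of `g•U₀` and the datum (architect px17 g23 2026-09-01T02:05Z (3)) -/

section CoarseGradient

variable {P : Params} {j : ℕ} {G : Type*} [GaugeGroup G]

/-- `a·V·b⁻¹ = W` ⟹ `dist1 (b·a⁻¹) ≤ dist1 W + dist1 V` (`b·a⁻¹ = (b·V·b⁻¹)·W⁻¹`). [folklore] -/
theorem dist1_grad_le_of_conj_eq (a b V W : G) (h : a * V * b⁻¹ = W) : dist1 (b * a⁻¹) ≤ dist1 W + dist1 V := by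
  have e : b * a⁻¹ = (b * V * b⁻¹) * W⁻¹ := by rw [← h]; group
  rw [e, add_comm]
  refine (GaugeGroup.dist1_mul_le _ _).trans (add_le_add (le_of_eq (GaugeGroup.dist1_conj _ _)) (le_of_eq (GaugeGroup.dist1_inv _)))

/-- THE GRADIENT OF A GAUGE TRANSFORMATION FROM THE FIELD IT PRODUCES: `dist1 (t B₊·(t B₋)⁻¹) ≤ dist1 ((t•V) B) + dist1 (V B)` on every bond.
[cite: Balaban1985Averaging, (8) p.18] -/
theorem dist1_bondGrad_le_gaugeAct_add (t : Site P j → G) (V : GaugeField P j G) (B : PBond P j) :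
    dist1 (t B.tgt * (t B.src)⁻¹) ≤ dist1 (GaugeField.gaugeAct t V B) + dist1 (V B) :=
  dist1_grad_le_of_conj_eq _ _ _ _ rfl

end CoarseGradient

section CoarseGradientT3

variable (F : T3Family) {J K : ℕ} (hJK : J ≤ K)

/-- ★ **THE COARSE GRADIENT OF `g↓` IS SMALL WHEN THE DESCENT OF `g•U₀` AND THE DATUM HAVE SMALL BONDS** (`(g•U₀)↓ = g↓•(U₀↓)`, lit ✓`descendTo_gaugeAct`):
for `U₀` over `V`, `dist1 ((descendTo (g•U₀)) B) ≤ s′` and `dist1 (V B) ≤ σ_V` on every coarse bond ⟹ `dist1 (g↓ B₊·(g↓ B₋)⁻¹) ≤ s′ + σ_V` — the `hgrad` input of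
(RES-u.7)'s lift letter at `t := g↓`, in its `tgt·src⁻¹` orientation (`s′`: the averaging word bound of a fine-small field, row (REG-UP) C; `σ_V`: the datum in its √θ-gauge).
[cite: Balaban1985Averaging, (8) p.18, (11)-(13) p.19] -/
theorem bondGrad_descTransf_le_of_descent {g : Site (F.P K) 0 → Matrix.specialUnitaryGroup (Fin 2) ℂ}
    {U₀ : GaugeField (F.P K) 0 (Matrix.specialUnitaryGroup (Fin 2) ℂ)} {V : GaugeField (F.P J) 0 (Matrix.specialUnitaryGroup (Fin 2) ℂ)} {s' σV : ℝ}
    (hU₀ : U₀ ∈ fibre F ℰp J K hJK V)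
    (hdesc : ∀ B : PBond (F.P J) 0, dist1 (descendTo F ℰp J K hJK (GaugeField.gaugeAct g U₀) B) ≤ s')
    (hσV : ∀ B : PBond (F.P J) 0, dist1 (V B) ≤ σV) :
    ∀ B : PBond (F.P J) 0, dist1 (descTransf F J K hJK g B.tgt * (descTransf F J K hJK g B.src)⁻¹) ≤ s' + σV := by
  have hV : descendTo F ℰp J K hJK U₀ = V := hU₀
  intro B
  have h1 := dist1_bondGrad_le_gaugeAct_add (descTransf F J K hJK g) V B
  rw [← hV, ← descendTo_gaugeAct, hV] at h1
  exact h1.trans (add_le_add (hdesc B) (hσV B))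

end CoarseGradientT3

end Summit.QuantumFields.YangMills.Theorems.FluctuationComparisonRegPrIntLS2BetaSmoothResidualCopy

end
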